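import Summits.HubbardSuperconductivity.HubbardSuperconductivity.Theses.LevyLogBootstrap
import Summits.HubbardSuperconductivity.HubbardSuperconductivity.Theorems.LevyLogBootstrapBlock2InfDivXXZKernelCovariance
import Literature.MathematicalPhysics.QuantumLattice.LiebMattisLadder
import HarnessLib

/-!
# Crux `LevyTransport` (stmt-HubbardSuperconductivity-15049, route `LevyLogBootstrap`), line `birth`:
# Perron–Frobenius positivity of the transverse kernel for EVERY real anisotropy `Δ`

Helper for the stubs `stub_levyFloor` (quantified over all real `Δ`) and `stub_levyMassBranch`
(strict positivity makes `log K₂` genuine) of `Cruxes/LevyTransport/Lines/birth.lean`: for even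
`M ≥ 4`, EVERY real `Δ` and every normalised `S^z_tot = 0` sector ground state `ψ` of
`xxzHamiltonian 1 (torusGraph 2 M) (-1) Δ`, `0 < Re⟨ψ, S⁺_{x'} S⁻_{y'} ψ⟩` for all sites. The landed
`stub_transverseKernelPos` of crux `Block2InfDivXXZ` states this only under the (unused) hypothesis
`Δ ∈ [-1, 0]`; the proof is the same: `J = -1` makes the Hamiltonian stoquastic in the Ising basis
for every `Δ` (`leadPF_entries` at zero field), the torus is connected, the sector ground state is
`c • ψ₀` with `ψ₀` the strictly positive Perron vector (`xxz_sector_perronFrobenius`,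
`sector_groundVec_pos`), and `S⁺_{x'} S⁻_{y'}` is entrywise nonnegative real with a witness entry `1`
inside the sector. Registered on the item as the `∀`-closed sub-goal `transverseKernelPos_allDelta`.
Marshall (1955); Tasaki (2020) §2.4; Kennedy–Lieb–Shastry (1988). No definition; sorry-free.
-/

noncomputable section

set_option linter.dupNamespace false

namespace Summit.HubbardSuperconductivity.HubbardSuperconductivity.Theorems.LevyLogBootstrap

open scoped BigOperators Matrix ComplexOrder
open Matrix Finset Complex
open Literature.MathematicalPhysics.QuantumLattice Literature.Probability.LatticeModels
open Summit.AtomisticToContinuum.BoseEinsteinCondensation.Theorems.BECStronglyRayleighSectorPerron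
open Summit.AtomisticToContinuum.BoseEinsteinCondensation.Theorems.InsertionFieldDelocalisation.Negative
open Summit.HubbardSuperconductivity.HubbardSuperconductivity.Theorems.PolyaSchurPairBoson

namespace LevyFloor

section Model

variable (M : ℕ) [NeZero M]

/-- **Perron–Frobenius positivity of the transverse kernel for EVERY real `Δ`** (the landed
`stub_transverseKernelPos` of crux `Block2InfDivXXZ` carries the unused hypothesis `Δ ∈ [-1,0]`;
`stub_levyFloor` quantifies over all real `Δ`): for even `M ≥ 4` and every normalised
`S^z_tot = 0` sector ground state `ψ` of `xxzHamiltonian 1 (torusGraph 2 M) (-1) Δ`,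
`0 < Re⟨ψ, S⁺_{x'} S⁻_{y'} ψ⟩`. Same proof: `J = -1` makes the Hamiltonian stoquastic for every
`Δ` (`leadPF_entries` at zero field), the sector ground state is `c • ψ₀` with `ψ₀` the strictly
positive Perron vector (`xxz_sector_perronFrobenius`, `sector_groundVec_pos`), and `S⁺_{x'}S⁻_{y'}`
is entrywise nonnegative with a witness entry `1` in the sector. Marshall (1955); Tasaki (2020)
§2.4. [folklore] -/
theorem transverseKernel_pos_all (hEven : Even M) (h4 : 4 ≤ M) (Δ : ℝ)
    (ψ : TensorIndex (TorusSite 2 M) 2 → ℂ)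
    (hψ : ψ ∈ @spinZSector (TorusSite 2 M) _ _ 1 0) (hnorm : star ψ ⬝ᵥ ψ = 1)
    (heig : Matrix.mulVec (xxzHamiltonian 1 (torusGraph 2 M) (-1) Δ) ψ =
      ((lowestEnergyInSector 1 (xxzHamiltonian 1 (torusGraph 2 M) (-1) Δ) 0 : ℝ) : ℂ) • ψ)
    (x' y' : TorusSite 2 M) :
    0 < (star ψ ⬝ᵥ Matrix.mulVec (onSite x' (spinRaise 1) * onSite y' (spinLower 1)) ψ).re := by
  obtain ⟨k, hk⟩ := hEven
  -- the weight of the `S^z_tot = 0` sector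
  set W : ℕ := 2 * k * k with hWdef
  have hk2 : 2 ≤ k := by omega
  have hcardU : (Finset.univ : Finset (TorusSite 2 M)).card = M ^ 2 := by
    rw [Finset.card_univ, card_torusSite]
  have hM2 : M ^ 2 = 4 * k * k := by rw [hk]; ring
  have hWle : W ≤ M ^ 2 := by rw [hM2, hWdef]; nlinarith
  have hW1 : 1 ≤ W := by rw [hWdef]; nlinarith
  have hWlt : W + 2 ≤ M ^ 2 := by rw [hM2, hWdef]; nlinarith
  have hsecR : ((Fintype.card (TorusSite 2 M) * 1 : ℕ) : ℝ) / 2 - (W : ℝ) = 0 := by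
    rw [card_torusSite, hWdef, hk]
    push_cast
    ring
  set H := xxzHamiltonian 1 (torusGraph 2 M) (-1) Δ with hHdef
  -- entries of `H`: stoquastic, weight preserving (zero field)
  have hent :=
    Summit.AtomisticToContinuum.BoseEinsteinCondensation.Cruxes.GroundStateStability.StableConeVariationalSelection.leadPF_entries
      (torusGraph 2 M) Δ (fun _ => (0 : ℝ))
  simp only [Complex.ofReal_zero, zero_smul, Finset.sum_const_zero, add_zero] at hent
  obtain ⟨happ, hreal, -, hoff, -⟩ := hent
  have hhop : ∀ σ τ : TensorIndex (TorusSite 2 M) 2, σ ≠ τ →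
      heisenbergHamiltonian 1 (torusGraph 2 M) 1 σ τ ≠ 0 → H σ τ ≠ 0 :=
    fun σ τ hστ h h0 => h (neg_eq_zero.1 ((happ σ τ hστ).symm.trans h0))
  have hWex : ∃ σ : TensorIndex (TorusSite 2 M) 2, (∑ z, (σ z : ℕ)) = W :=
    exists_config_weight_eq 2 M W hWle
  -- the Perron vector of the sector: nonnegative (landed), unique, hence strictly positive
  obtain ⟨⟨ψ₀, hψ₀K, hψ₀0, hψ₀nn, hHψ₀⟩, huniq⟩ :=
    xxz_sector_perronFrobenius (torusGraph 2 M) (torusGraph_connected 2 M) Δ W hWex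
  have hoffK : ∀ σ, (∑ z, (σ z : ℕ)) ≠ W → ψ₀ σ = 0 :=
    (LiebMattis.mem_spinZSector_weight_iff 1 W ψ₀).1 hψ₀K
  have hpos : ∀ σ, (∑ z, (σ z : ℕ)) = W → 0 < (ψ₀ σ).re :=
    sector_groundVec_pos 1 (torusGraph 2 M) (torusGraph_connected 2 M) H hhop hreal hoff W hoffK
      hψ₀nn hHψ₀ hψ₀0
  rw [hsecR] at hψ₀K hHψ₀ huniq
  obtain ⟨c, hc⟩ := huniq ψ₀ ψ hψ₀K hψ hHψ₀ heig hψ₀0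
  have hc0 : c ≠ 0 := by
    rintro rfl
    rw [zero_smul] at hc
    rw [hc, star_zero, zero_dotProduct] at hnorm
    exact zero_ne_one hnorm
  -- reduce to the Perron vector
  set A : Op (TorusSite 2 M) 2 := onSite x' (spinRaise 1) * onSite y' (spinLower 1) with hAdef
  have hcc : star c * c = ((‖c‖ ^ 2 : ℝ) : ℂ) := by
    rw [Complex.star_def, Complex.conj_mul']
    push_cast
    rfl
  have hquad : star ψ ⬝ᵥ A *ᵥ ψ = ((‖c‖ ^ 2 : ℝ) : ℂ) * (star ψ₀ ⬝ᵥ A *ᵥ ψ₀) := by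
    rw [hc, mulVec_smul, star_smul, smul_dotProduct, dotProduct_smul, smul_smul, hcc, smul_eq_mul]
  rw [hquad, Complex.re_ofReal_mul]
  refine mul_pos (by positivity) ?_
  have hA : ∀ σ τ, 0 ≤ (A σ τ).re ∧ (A σ τ).im = 0 := fun σ τ => raiseLower_nnreal x' y' σ τ
  -- the witness pair
  by_cases hxy : x' = y'
  · subst hxy
    obtain ⟨S, hSsub, hScard⟩ := Finset.exists_subset_card_eq
      (s := (Finset.univ : Finset (TorusSite 2 M)).erase x') (n := W)
      (by rw [Finset.card_erase_of_mem (Finset.mem_univ _), hcardU]; omega)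
    have hxS : x' ∉ S := fun h => (Finset.mem_erase.1 (hSsub h)).1 rfl
    set σ₀ : TensorIndex (TorusSite 2 M) 2 := fun z => if z ∈ S then 1 else 0 with hσ₀def
    have hσ₀W : (∑ z, (σ₀ z : ℕ)) = W := by rw [hσ₀def, weight_indicator, hScard]
    have hσ₀x : σ₀ x' = 0 := by simp [hσ₀def, hxS]
    refine lt_of_lt_of_le ?_ (re_quadForm_ge_entry A ψ₀ hA hψ₀nn σ₀ σ₀)
    rw [hAdef, raiseLower_witness_eq x' σ₀ hσ₀x, Complex.one_re, mul_one]
    exact mul_pos (hpos σ₀ hσ₀W) (hpos σ₀ hσ₀W)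
  · obtain ⟨T, hTsub, hTcard⟩ := Finset.exists_subset_card_eq
      (s := ((Finset.univ : Finset (TorusSite 2 M)).erase x').erase y') (n := W - 1)
      (by
        rw [Finset.card_erase_of_mem (Finset.mem_erase.2 ⟨Ne.symm hxy, Finset.mem_univ _⟩),
          Finset.card_erase_of_mem (Finset.mem_univ _), hcardU]
        omega)
    have hyT : y' ∉ T := fun h => (Finset.mem_erase.1 (hTsub h)).1 rfl
    have hxT : x' ∉ T := fun h => (Finset.mem_erase.1 (Finset.mem_erase.1 (hTsub h)).2).1 rfl
    set S := insert y' T with hSdef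
    have hxS : x' ∉ S := by
      rw [hSdef, Finset.mem_insert]
      rintro (h | h)
      · exact hxy h
      · exact hxT h
    have hyS : y' ∈ S := Finset.mem_insert_self _ _
    have hScard : S.card = W := by
      rw [hSdef, Finset.card_insert_of_notMem hyT, hTcard]
      omega
    set σ₀ : TensorIndex (TorusSite 2 M) 2 := fun z => if z ∈ S then 1 else 0 with hσ₀def
    have hσ₀W : (∑ z, (σ₀ z : ℕ)) = W := by rw [hσ₀def, weight_indicator, hScard]
    have hσ₀x : σ₀ x' = 0 := by simp [hσ₀def, hxS]
    have hσ₀y : σ₀ y' = 1 := by simp [hσ₀def, hyS]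
    set τ₀ : TensorIndex (TorusSite 2 M) 2 := Function.update (Function.update σ₀ x' 1) y' 0
      with hτ₀def
    have hτ₀eq : τ₀ = fun z => if z ∈ insert x' T then 1 else 0 := by
      funext z
      rw [hτ₀def]
      by_cases hzy : z = y'
      · subst hzy
        rw [Function.update_self, if_neg]
        rw [Finset.mem_insert]
        rintro (h | h)
        · exact hxy h.symm
        · exact hyT h
      · rw [Function.update_of_ne hzy]
        by_cases hzx : z = x'
        · subst hzx
          rw [Function.update_self, if_pos (Finset.mem_insert_self _ _)]
        · rw [Function.update_of_ne hzx, hσ₀def]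
          simp only [hSdef, Finset.mem_insert, hzy, hzx, false_or]
    have hτ₀W : (∑ z, (τ₀ z : ℕ)) = W := by
      rw [hτ₀eq, weight_indicator, Finset.card_insert_of_notMem hxT, hTcard]
      omega
    refine lt_of_lt_of_le ?_ (re_quadForm_ge_entry A ψ₀ hA hψ₀nn σ₀ τ₀)
    rw [hAdef, hτ₀def, raiseLower_witness_ne hxy σ₀ hσ₀x hσ₀y, Complex.one_re, mul_one]
    exact mul_pos (hpos σ₀ hσ₀W) (hpos τ₀ (hτ₀def ▸ hτ₀W))

end Model

end LevyFloor

open LevyFloor in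
/-- **Registered sub-goal `transverseKernelPos_allDelta` (crux `LevyTransport`)**: the `∀`-closed
form of `LevyFloor.transverseKernel_pos_all` — Perron–Frobenius positivity of the transverse kernel
of every normalised half-filled sector ground state, for every real `Δ`. [folklore] -/
theorem transverseKernelPos_allDelta :
    ∀ (M : ℕ) [NeZero M], Even M → 4 ≤ M → ∀ (Δ : ℝ) (ψ : TensorIndex (TorusSite 2 M) 2 → ℂ),
      ψ ∈ @spinZSector (TorusSite 2 M) _ _ 1 0 → star ψ ⬝ᵥ ψ = 1 →
      Matrix.mulVec (xxzHamiltonian 1 (torusGraph 2 M) (-1) Δ) ψ =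
        ((lowestEnergyInSector 1 (xxzHamiltonian 1 (torusGraph 2 M) (-1) Δ) 0 : ℝ) : ℂ) • ψ →
      ∀ x' y' : TorusSite 2 M,
        0 < (star ψ ⬝ᵥ Matrix.mulVec (onSite x' (spinRaise 1) * onSite y' (spinLower 1)) ψ).re :=
  fun M _ hM h4 Δ ψ hψ hnorm heig x' y' =>
    transverseKernel_pos_all M hM h4 Δ ψ hψ hnorm heig x' y'

end Summit.HubbardSuperconductivity.HubbardSuperconductivity.Theorems.LevyLogBootstrap

end
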